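import Summits.CriticalPhenomena.SAWScalingLimit.Theses.SAWRestrictionRigidity
import Summits.CriticalPhenomena.SAWScalingLimit.Theorems.SAWRestrictionRigidityRigidityIffRepairAndRado
import Summits.CriticalPhenomena.SAWScalingLimit.Theorems.SAWRestrictionRigidityRigidityDiscCoreIffRepair
import Summits.CriticalPhenomena.SAWScalingLimit.Theorems.SAWRestrictionRigidityRigidityDpDiscOfMarkFixing
import Summits.CriticalPhenomena.SAWScalingLimit.Theorems.SAWRestrictionRigidityRigidityRadoExtensionDiscDP
import Summits.CriticalPhenomena.SAWScalingLimit.Theorems.SAWRestrictionRigidityRigiditySleOfDPCovariance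
import Summits.CriticalPhenomena.SAWScalingLimit.Theorems.SAWRestrictionRigidityRigidityDpCovarianceOfDisc
import Literature.Probability.RandomPlanarGeometry.ConformalRestrictionCovariance
import Literature.Probability.RandomPlanarGeometry.RadoContinuity

/-!
# Certificate of the mark-fixing cut (line `registered` v6, lead c8), crux `Rigidity` (stmt-CriticalPhenomena-1368), routes SAWRestrictionRigidity + SAWZoomRigidity

Target: `Summits/CriticalPhenomena/SAWScalingLimit/Theorems/SAWRestrictionRigidityRigidityDiscCoreMFIffRepair.lean`
(`--supports stmt-CriticalPhenomena-1368`).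

The v6 skeleton (`Cruxes/Rigidity/Lines/registered.lean`) cuts the repaired crux C′ ("the seven
lattice-exact axioms + Radó continuity ⇒ conformal covariance", LSW04 §3.4.5) at the MARK-FIXING
reference disc: `stub_discCoreMarkFixing` asks only that the law of a two-marked unit disc
transport along univalent maps near the closed disc which FIX BOTH MARKS. The four bookkeeping /
transport stubs between it and conformal covariance are landed (p172687 `stub_dpDiscOfMarkFixing`,
p172799 `stub_radoExtensionDiscDP`, p172898 `stub_dpCovarianceOfDisc`, p172881
`stub_sleOfDPCovariance` — the last one being the new mechanism: LSW03 applied to ROTATED families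
makes isotropy and the motion of the marks OUTPUT). This file records, kernel-checked:

* `isSLELaw_of_discCoreMarkFixing` — for ONE family: chordal + restriction + lattice-similarity
  covariance + simple curves + Radó continuity + mark-fixing disc covariance ⇒ every law is chordal
  SLE(8/3) (no Markov property, no reversibility used);
* `discCoreMarkFixing_iff_repair` — the open stub is EQUIVALENT to C′ (so the cut is faithful: the
  stub is not stronger than the repaired crux), and `discCoreMarkFixing_iff_discCoreAnalytic` — it
  is equivalent to c7's all-maps disc core (p168875) although it quantifies over 4 fewer real
  parameters and asks for no rotation covariance;
* `rigidity_iff_discCoreMarkFixing_and_rado`, `rigidity_iff_discCoreMarkFixing_and_not_nonRadoAxiomsFamily`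
  — the crux AS TYPED is `stub_discCoreMarkFixing ∧ stub_axiomsForceRado`, the second conjunct being
  literally `¬ NonRadoAxiomsFamily` (p159714, p168963).

References: G. F. Lawler, O. Schramm, W. Werner, *Conformal restriction: the chordal case* (2003),
p. 5 result 2 [LawlerSchrammWerner2003Restriction]; W. Werner, *Conformal restriction and related
questions* (2003), §1.2 p. 6 (the mark-fixing formulation "a conformal map Φ from D onto D′ that
leaves A and B invariant") [arXiv:math/0307353].
-/

namespace Summit.CriticalPhenomena.SAWScalingLimit.Cruxes.Rigidity.MarkFixing

open MeasureTheory Set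
open Literature.Probability.RandomPlanarGeometry

/-- **Mark-fixing disc covariance forces SLE(8/3)** (one family at a time): a chordal family with two-sided restriction, covariance under the lattice similarities (only real dilations and translations are used), simple boundary-avoiding curves and Radó continuity, whose two-marked unit-disc laws transport along every univalent map near the closed disc FIXING BOTH MARKS, is the chordal SLE(8/3) law in EVERY Dobrushin domain. Composition of the landed stubs p172687 → p172799 → p172898 → p172881; neither the Markov property nor reversibility is used. [cite: LawlerSchrammWerner2003Restriction, p. 5 result 2] -/
theorem isSLELaw_of_discCoreMarkFixing (P : ChordalFamily) (hch : P.IsChordal) (hres : P.IsRestriction)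
    (hLS : P.IsLatticeSimilarityCovariant) (hS : P.IsCarriedBySimpleCurves) (hRado : P.IsRadoContinuous)
    (hMF : ∀ (D₀ D' : DobrushinDomain) (Φ : C(ℂ, ℂ)) (U : Set ℂ), D₀.carrier = Metric.ball 0 1 → IsOpen U →
      closure D₀.carrier ⊆ U → DifferentiableOn ℂ Φ U → Set.InjOn Φ U → Φ (D₀.pt 0) = D₀.pt 0 →
      Φ (D₀.pt 1) = D₀.pt 1 → D'.carrier = Φ '' D₀.carrier → D'.pt 0 = D₀.pt 0 → D'.pt 1 = D₀.pt 1 →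
      P D' = (P D₀).map (CurveClass.map Φ)) :
    ∀ D : DobrushinDomain, IsSLELaw ((8 : NNReal) / 3) D (P D) :=
  stub_sleOfDPCovariance P hch hres hS
    (stub_dpCovarianceOfDisc P (stub_radoExtensionDiscDP P hch hRado (stub_dpDiscOfMarkFixing P hLS hMF)))

/-- **Mark-fixing disc covariance forces conformal covariance** (one family at a time; corollary of `isSLELaw_of_discCoreMarkFixing` and `ChordalFamily.isConformallyCovariant_of_isSLELaw`). [folklore] -/
theorem isConformallyCovariant_of_discCoreMarkFixing (P : ChordalFamily) (hch : P.IsChordal)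
    (hres : P.IsRestriction) (hLS : P.IsLatticeSimilarityCovariant) (hS : P.IsCarriedBySimpleCurves)
    (hRado : P.IsRadoContinuous)
    (hMF : ∀ (D₀ D' : DobrushinDomain) (Φ : C(ℂ, ℂ)) (U : Set ℂ), D₀.carrier = Metric.ball 0 1 → IsOpen U →
      closure D₀.carrier ⊆ U → DifferentiableOn ℂ Φ U → Set.InjOn Φ U → Φ (D₀.pt 0) = D₀.pt 0 →
      Φ (D₀.pt 1) = D₀.pt 1 → D'.carrier = Φ '' D₀.carrier → D'.pt 0 = D₀.pt 0 → D'.pt 1 = D₀.pt 1 →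
      P D' = (P D₀).map (CurveClass.map Φ)) :
    P.IsConformallyCovariant :=
  ChordalFamily.isConformallyCovariant_of_isSLELaw (isSLELaw_of_discCoreMarkFixing P hch hres hLS hS hRado hMF)

/-- **A conformally covariant family has mark-fixing disc covariance** (the trivial converse: `IsConformallyCovariant.eq_map_of_image` with the image marks rewritten through `Φ a = a`, `Φ b = b`). [folklore] -/
theorem discCoreMarkFixing_of_isConformallyCovariant (P : ChordalFamily) (hcov : P.IsConformallyCovariant) :
    ∀ (D₀ D' : DobrushinDomain) (Φ : C(ℂ, ℂ)) (U : Set ℂ), D₀.carrier = Metric.ball 0 1 → IsOpen U →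
      closure D₀.carrier ⊆ U → DifferentiableOn ℂ Φ U → Set.InjOn Φ U → Φ (D₀.pt 0) = D₀.pt 0 →
      Φ (D₀.pt 1) = D₀.pt 1 → D'.carrier = Φ '' D₀.carrier → D'.pt 0 = D₀.pt 0 → D'.pt 1 = D₀.pt 1 →
      P D' = (P D₀).map (CurveClass.map Φ) := by
  intro D₀ D' Φ U _ _ hcl hΦd hΦi ha hb hD' h0 h1
  have hsub : D₀.carrier ⊆ U := subset_closure.trans hcl
  exact hcov.eq_map_of_image (hΦd.mono hsub) (hΦi.mono hsub) hD' (by rw [h0, ha]) (by rw [h1, hb])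

/-- **The open stub of v6 is equivalent to the repaired crux C′** (`stub_discCoreMarkFixing ↔ C′`, both as closed statements over all families with the seven axioms and Radó continuity): `→` by `isConformallyCovariant_of_discCoreMarkFixing`, `←` by `discCoreMarkFixing_of_isConformallyCovariant`. So the mark-fixing cut is FAITHFUL — its open stub is no stronger than C′ — while its quantifier range (mark-fixing univalent maps of the disc) is the smallest recorded for this crux. [folklore] -/
theorem discCoreMarkFixing_iff_repair :
    (∀ P : ChordalFamily, P.IsChordal → P.IsRestriction → P.IsRestrictionMarkov → P.IsReversible →
      P.IsLatticeSimilarityCovariant → P.IsCarriedBySimpleCurves → P.IsRadoContinuous →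
      ∀ (D₀ D' : DobrushinDomain) (Φ : C(ℂ, ℂ)) (U : Set ℂ), D₀.carrier = Metric.ball 0 1 → IsOpen U →
        closure D₀.carrier ⊆ U → DifferentiableOn ℂ Φ U → Set.InjOn Φ U → Φ (D₀.pt 0) = D₀.pt 0 →
        Φ (D₀.pt 1) = D₀.pt 1 → D'.carrier = Φ '' D₀.carrier → D'.pt 0 = D₀.pt 0 → D'.pt 1 = D₀.pt 1 →
        P D' = (P D₀).map (CurveClass.map Φ)) ↔
    (∀ P : ChordalFamily, P.IsChordal → P.IsRestriction → P.IsRestrictionMarkov → P.IsReversible →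
      P.IsLatticeSimilarityCovariant → P.IsCarriedBySimpleCurves → P.IsRadoContinuous →
      P.IsConformallyCovariant) := by
  constructor
  · intro h P hch hres hRM hrev hLS hS hRado
    exact isConformallyCovariant_of_discCoreMarkFixing P hch hres hLS hS hRado
      (h P hch hres hRM hrev hLS hS hRado)
  · intro h P hch hres hRM hrev hLS hS hRado
    exact discCoreMarkFixing_of_isConformallyCovariant P (h P hch hres hRM hrev hLS hS hRado)

/-- **The mark-fixing disc core is equivalent to c7's all-maps disc core** (`Dichotomy.stub_discCoreAnalytic`, certificate p168875 `discCoreAnalytic_iff_repair`): both are equivalent to C′. The mark-fixing form asks for 4 fewer real parameters of maps and for no rotation / moving-mark covariance; the difference is supplied by LSW03 on rotated families (p172881). [folklore] -/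
theorem discCoreMarkFixing_iff_discCoreAnalytic :
    (∀ P : ChordalFamily, P.IsChordal → P.IsRestriction → P.IsRestrictionMarkov → P.IsReversible →
      P.IsLatticeSimilarityCovariant → P.IsCarriedBySimpleCurves → P.IsRadoContinuous →
      ∀ (D₀ D' : DobrushinDomain) (Φ : C(ℂ, ℂ)) (U : Set ℂ), D₀.carrier = Metric.ball 0 1 → IsOpen U →
        closure D₀.carrier ⊆ U → DifferentiableOn ℂ Φ U → Set.InjOn Φ U → Φ (D₀.pt 0) = D₀.pt 0 →
        Φ (D₀.pt 1) = D₀.pt 1 → D'.carrier = Φ '' D₀.carrier → D'.pt 0 = D₀.pt 0 → D'.pt 1 = D₀.pt 1 →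
        P D' = (P D₀).map (CurveClass.map Φ)) ↔
    (∀ P : ChordalFamily, P.IsChordal → P.IsRestriction → P.IsRestrictionMarkov → P.IsReversible →
      P.IsLatticeSimilarityCovariant → P.IsCarriedBySimpleCurves → P.IsRadoContinuous →
      ∀ (D₀ D' : DobrushinDomain) (Φ : C(ℂ, ℂ)) (U : Set ℂ), D₀.carrier = Metric.ball 0 1 → IsOpen U →
        closure D₀.carrier ⊆ U → DifferentiableOn ℂ Φ U → Set.InjOn Φ U →
        D'.carrier = Φ '' D₀.carrier → D'.pt 0 = Φ (D₀.pt 0) → D'.pt 1 = Φ (D₀.pt 1) →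
        P D' = (P D₀).map (CurveClass.map Φ)) :=
  discCoreMarkFixing_iff_repair.trans Dichotomy.discCoreAnalytic_iff_repair.symm

/-- **The crux AS TYPED ↔ mark-fixing disc core ∧ AxiomsForceRado**: `Rigidity` is equivalent to the conjunction of the v6 open stub `stub_discCoreMarkFixing` and the SAW-irrelevant regularity stub `stub_axiomsForceRado` (through `Repair.rigidity_iff_repair_and_rado`, p159660). [folklore] -/
theorem rigidity_iff_discCoreMarkFixing_and_rado :
    Summit.CriticalPhenomena.SAWScalingLimit.Theses.SAWRestrictionRigidity.Rigidity ↔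
      ((∀ P : ChordalFamily, P.IsChordal → P.IsRestriction → P.IsRestrictionMarkov → P.IsReversible →
        P.IsLatticeSimilarityCovariant → P.IsCarriedBySimpleCurves → P.IsRadoContinuous →
        ∀ (D₀ D' : DobrushinDomain) (Φ : C(ℂ, ℂ)) (U : Set ℂ), D₀.carrier = Metric.ball 0 1 → IsOpen U →
          closure D₀.carrier ⊆ U → DifferentiableOn ℂ Φ U → Set.InjOn Φ U → Φ (D₀.pt 0) = D₀.pt 0 →
          Φ (D₀.pt 1) = D₀.pt 1 → D'.carrier = Φ '' D₀.carrier → D'.pt 0 = D₀.pt 0 → D'.pt 1 = D₀.pt 1 →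
          P D' = (P D₀).map (CurveClass.map Φ)) ∧
      (∀ P : ChordalFamily, P.IsChordal → P.IsRestriction → P.IsRestrictionMarkov → P.IsReversible →
        P.IsLatticeSimilarityCovariant → P.IsCarriedBySimpleCurves → P.IsRadoContinuous)) := by
  rw [Repair.rigidity_iff_repair_and_rado, discCoreMarkFixing_iff_repair]

/-- **The crux AS TYPED ↔ mark-fixing disc core ∧ ¬NonRadoAxiomsFamily**: the residue of the typed crux beyond the (mark-fixing form of the) repaired open problem is literally the non-existence of a seven-axioms family that fails Radó continuity (`Dichotomy.axiomsForceRado_iff_not_nonRadoAxiomsFamily`, p168963; negative lemma p159714). [folklore] -/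
theorem rigidity_iff_discCoreMarkFixing_and_not_nonRadoAxiomsFamily :
    Summit.CriticalPhenomena.SAWScalingLimit.Theses.SAWRestrictionRigidity.Rigidity ↔
      ((∀ P : ChordalFamily, P.IsChordal → P.IsRestriction → P.IsRestrictionMarkov → P.IsReversible →
        P.IsLatticeSimilarityCovariant → P.IsCarriedBySimpleCurves → P.IsRadoContinuous →
        ∀ (D₀ D' : DobrushinDomain) (Φ : C(ℂ, ℂ)) (U : Set ℂ), D₀.carrier = Metric.ball 0 1 → IsOpen U →
          closure D₀.carrier ⊆ U → DifferentiableOn ℂ Φ U → Set.InjOn Φ U → Φ (D₀.pt 0) = D₀.pt 0 →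
          Φ (D₀.pt 1) = D₀.pt 1 → D'.carrier = Φ '' D₀.carrier → D'.pt 0 = D₀.pt 0 → D'.pt 1 = D₀.pt 1 →
          P D' = (P D₀).map (CurveClass.map Φ)) ∧
      ¬ Summit.CriticalPhenomena.SAWScalingLimit.Theorems.Rigidity.Negative.NonRadoAxiomsFamily) := by
  rw [rigidity_iff_discCoreMarkFixing_and_rado, Dichotomy.axiomsForceRado_iff_not_nonRadoAxiomsFamily]

end Summit.CriticalPhenomena.SAWScalingLimit.Cruxes.Rigidity.MarkFixing
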